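import Literature.Analysis.FluidPDE.PeriodicLiouvilleReduction
import Literature.Analysis.FluidPDE.PeriodicSwirlData
import Literature.Analysis.FluidPDE.PeriodicSwirlVanishing
import HarnessLib

/-!
# Lei–Ren–Zhang 2019, Theorem 1.1 from the one-step oscillation decay

Analysis/FluidPDE proofs file (theorems only, no definitions, no named facts), on the discharge
path of the named fact `Literature.Analysis.FluidPDE.leiRenZhang2019_liouville_periodic`
(Z. Lei, X. Ren, Q. S. Zhang, arXiv:1902.11229 = Math. Ann. 383 (2022), Theorem 1.1). The whole
proof of Theorem 1.1 (arXiv p. 9) assembled from the tree: KNSS §4 regularity and the periodic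
swirl data (`periodic_swirl_data_of_boundedWeak`), the oscillation iteration
(`periodic_swirl_setting_eq_zero`), the transfer back and KNSS Theorem 5.2
(`liouville_periodic_of_boundedWeak_swirl_free`) — GIVEN the one-step oscillation decay of the
periodic swirl setting with constants depending only on the period `P`, the drift bound and the
angular-potential constant (hypothesis `hOSC`: Lemma 2.1 + Corollary 3.2 + Lemma 3.3 of the paper,
the periodic twin of `LeiZhang2011.oscillation_step`; its mean value half is
`meanValue_inequality_periodic`, its logarithmic slice inequality `log_slice_bound_periodic`).
The discharge `leiRenZhang2019_liouville_periodic_holds` is then the three-line append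
`liouville_periodic_of_oscillation_step oscillation_step_periodic` to
`LeiRenZhang2019PeriodicLiouville`.

* `liouville_periodic_of_oscillation_step`.

## References

* Z. Lei, X. Ren, Q. S. Zhang, arXiv:1902.11229, Theorem 1.1 and its proof (arXiv pp. 4, 9).
  [LeiRenZhang2019]
-/

noncomputable section

open MeasureTheory Set Function Filter Metric intervalIntegral
open scoped InnerProductSpace RealInnerProductSpace Laplacian ContDiff

namespace Literature.Analysis.FluidPDE

namespace LeiRenZhang2019

open LeiZhang2011

/-- **Theorem 1.1 of Lei–Ren–Zhang 2019 from the one-step oscillation decay.** If for every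
period `P > 0`, drift bound `M_b` and potential constant `C_Φ` there are `0 < θ ≤ 1`,
`0 ≤ κ < 1`, `ρ₀ > 0` such that every periodic swirl setting datum `(F, N, b, Φ)` at radius
`ρ ≥ ρ₀` (hypotheses as output by `bundle_of_periodic_swirl_setting`, with `‖b‖ ≤ M_b`,
`|Φ| ≤ C_Φ r`) obeys "`m ≤ F ≤ M` on `[−ρ²,0] × {r ≤ ρ}` ⇒ `osc F ≤ κ(M − m)` on
`[−(θρ)²,0] × {r ≤ θρ}`", then every bounded ancient mild solution (`ν = 1`, duality form) with
measurable axisymmetric slices, bounded swirl and axially `P`-periodic slices is on every slice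
`t < 0` a.e. an axial constant `β e_z` — the statement of `leiRenZhang2019_liouville_periodic`. [cite: LeiRenZhang2019, Thm 1.1 (arXiv p. 4) and its proof (arXiv p. 9)] -/
theorem liouville_periodic_of_oscillation_step
    (hOSC : ∀ ⦃P : ℝ⦄, 0 < P → ∀ Mb CΦ : ℝ, ∃ θ κd ρ₀ : ℝ, 0 < θ ∧ θ ≤ 1 ∧ 0 ≤ κd ∧ κd < 1 ∧ 0 < ρ₀ ∧
      ∀ ⦃ρ : ℝ⦄, ρ₀ ≤ ρ → ∀ ⦃F N : ℝ → EuclideanSpace ℝ (Fin 3) → ℝ⦄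
        ⦃b : ℝ → EuclideanSpace ℝ (Fin 3) → EuclideanSpace ℝ (Fin 3)⦄
        ⦃Φ : ℝ → EuclideanSpace ℝ (Fin 3) → ℝ⦄,
      (∀ s, ContDiff ℝ 2 (F s)) → (∀ s, IsAxisymmetricScalar (F s)) →
      (∀ s x, cylRadius x = 0 → F s x = 0) → (∀ s, IsAxiallyPeriodic P (F s)) →
      (∀ s, ContDiff ℝ 1 (b s)) → (∀ s x, VectorCalculus.divergence (b s) x = 0) →
      (∀ s, IsAxiallyPeriodic P (b s)) → (∀ s x, ‖b s x‖ ≤ Mb) →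
      (∀ s, ContDiff ℝ 1 (Φ s)) → (∀ s, IsAxiallyPeriodic P (Φ s)) →
      (∀ s x, fderiv ℝ (Φ s) x eZ = ⟪b s x, horizPart x⟫) →
      (∀ s x, |Φ s x| ≤ CΦ * cylRadius x) →
      (∀ s x, N s x =
        (Δ (F s)) x - fderiv ℝ (F s) x (b s x) - 2 / cylRadius x * fderiv ℝ (F s) x (eR x)) →
      (∀ᵐ x ∂(volume : Measure (EuclideanSpace ℝ (Fin 3))),
        IntervalIntegrable (fun s => N s x) volume (-ρ ^ 2) 0 ∧
          ∀ s ∈ Icc (-ρ ^ 2) 0, F s x = F (-ρ ^ 2) x + ∫ σ in (-ρ ^ 2)..s, N σ x) →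
      (Continuous fun p : ℝ × EuclideanSpace ℝ (Fin 3) => F p.1 p.2) →
      (Continuous fun p : ℝ × EuclideanSpace ℝ (Fin 3) => gradient (F p.1) p.2) →
      AEStronglyMeasurable (fun p : ℝ × EuclideanSpace ℝ (Fin 3) => N p.1 p.2)
        ((volume.restrict (Ioc (-ρ ^ 2) 0)).prod volume) →
      Integrable (fun p : ℝ × EuclideanSpace ℝ (Fin 3) => N p.1 p.2)
        ((volume.restrict (Ioc (-ρ ^ 2) 0)).prod
          (volume.restrict {x : EuclideanSpace ℝ (Fin 3) | x 2 ∈ Icc 0 (2 * P) ∧ cylRadius x ≤ ρ})) →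
      ∀ ⦃m M : ℝ⦄, (∀ s ∈ Icc (-ρ ^ 2) 0, ∀ x, cylRadius x ≤ ρ → m ≤ F s x ∧ F s x ≤ M) →
      ∀ p ∈ Icc (-(θ * ρ) ^ 2) 0 ×ˢ {x : EuclideanSpace ℝ (Fin 3) | cylRadius x ≤ θ * ρ},
      ∀ q ∈ Icc (-(θ * ρ) ^ 2) 0 ×ˢ {x : EuclideanSpace ℝ (Fin 3) | cylRadius x ≤ θ * ρ},
        F p.1 p.2 - F q.1 q.2 ≤ κd * (M - m))
    (u : ℝ → EuclideanSpace ℝ (Fin 3) → EuclideanSpace ℝ (Fin 3))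
    (hu : IsBoundedAncientMildSolution 1 u) (hmeas : ∀ t < 0, AEStronglyMeasurable (u t) volume)
    (haxi : ∀ t < 0, IsAxisymmetric (u t))
    (hswirl : ∃ C : ℝ, ∀ t < 0, ∀ x, |swirl (u t) x| ≤ C)
    (hper : ∃ P : ℝ, 0 < P ∧ ∀ t < 0, Function.Periodic (u t) (P • eZ)) :
    ∀ t < 0, ∃ β : ℝ, u t =ᵐ[volume] fun _ => β • eZ := by
  refine liouville_periodic_of_boundedWeak_swirl_free ?_ u hu hmeas haxi hswirl hper
  intro v P hP hweak hax hsw hpv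
  obtain ⟨C, hC⟩ := hsw
  obtain ⟨U, β, CU, C₁, Cβ, hrep, h1, hfc, h2, h3, h4, h5, h6, hUs, hUdiv, hUax, hUper, hUm, hβm, hUb,
    hDU, hβb, hΓC, h11⟩ := periodic_swirl_data_of_boundedWeak hweak hax hC hpv
  obtain ⟨θ, κd, ρ₀, hθ0, hθ1, hκ0, hκ1, hρ₀, hosc⟩ := hOSC hP (CU + Cβ) (CU * P)
  have hzero : ∀ t < 0, ∀ x, swirl (U t) x = 0 :=
    periodic_swirl_setting_eq_zero (f := fun t x => swirl (U t) x) h1 hfc h2 h3 h4 h5 h6 hUs hUdiv hUax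
      hUper hUm hβm hUb hDU hβb h11 hP hΓC hθ0 hθ1 hκ0 hκ1 hρ₀ hosc
  exact swirl_ae_eq_zero_of_repr hrep hzero

end LeiRenZhang2019

end Literature.Analysis.FluidPDE

end
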